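import Summits.Ventures.PercRepro.S3ShadowLayers
import Summits.Ventures.PercRepro.RankLevelSetPlaneTen
import Summits.Ventures.PercRepro.TheoremNAll

/-!
# PercRepro — THE SHADOW LAYERS ON THE `e`-FREE CORE: `RLS` FROM THE LAYER SUM, AND THE LARGE-CORANK CELLS OF
THE `q = 6` WINDOW (p8, S3; part B of S3ShadowLayers)

`proofs/SUBCLAIM-S3-p8.md` §3b, continued. Part A (`S3ShadowLayers`) gives `ShadowHall M p q (Σ_{1 ≤ k < p−q} L_k)` for
any flat bound `F`. Here: **`rls_of_layers`** (`Φ(p, q) ≤ Σ_k L_k ⇒ RLS M p q`, through night-2's `c025_of_shadowHall`),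
**`card_le_coreBound_of_free`** (the `e`-free core's flat bound `F u = 44·2^{u−6} − 1` at every rank, from `f(6) ≤ 43`
and the cover recursion), **`rls_six_of_layers_core`**, the first-layer form **`rls_six_of_first_layer_core`**
(`7·Φ(p, 6) ≤ n − 43 ⇒ RLS M p 6`) and the kernel instances **`rls_nine_six_of_core (61 ≤ |E|)`**,
**`rls_ten_six_of_core (75)`**, **`rls_eleven_six_of_core (93)`**, **`rls_twelve_six_of_core (119)`** — the cells
`(9, d ≥ 52)`, `(10, d ≥ 65)`, `(11, d ≥ 82)`, `(12, d ≥ 107)` of the S3 map. Axioms: standard.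
-/

namespace PercRepro.ThmN

open Finset PerFlat ThmH Shadow

variable {α : Type}

/-- **`C025` on `M` from the layers**: if `Φ(p, q) ≤ Σ_{1 ≤ k < p − q} L_k` then `RLS M p q`. -/
theorem rls_of_layers [DecidableEq α] (M : Matroid α) [M.Finite] (p q : ℕ) (F : ℕ → ℕ)
    (hF : ∀ u : ℕ, ∀ X ⊆ gr M, M.eRk (X : Set α) ≤ (u : ℕ∞) → X.card ≤ F u)
    (hsum : phiK p q ≤ ∑ k ∈ Finset.Ico 1 (p - q), layerProd (gr M).card q F k) : RLS M p q :=
  c025_of_shadowHall (shadowHall_mono hsum (shadowHall_of_layers p q F hF))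

/-- The flat bound of the `e`-free core at every rank: `F u = 44·2^{u−6} − 1` (`= 43` for `u ≤ 6`), from
`f(6) ≤ 43` (PlaneTen) and the cover recursion `|X| ≤ 2B + 1` one rank up. -/
theorem card_le_coreBound_of_free [DecidableEq α] (M : Matroid α) [M.Finite]
    (hfree : ∀ e ∈ M.E, ∃ A ⊆ M.E \ {e}, e ∉ M.closure A ∧ e ∉ M.closure ((M.E \ {e}) \ A)) :
    ∀ u : ℕ, ∀ X ⊆ gr M, M.eRk (X : Set α) ≤ (u : ℕ∞) → X.card ≤ 44 * 2 ^ (u - 6) - 1 := by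
  -- the Set form first
  have key : ∀ i : ℕ, ∀ X ⊆ M.E, M.eRk X ≤ ((6 + i : ℕ) : ℕ∞) → X.ncard ≤ 44 * 2 ^ i - 1 := by
    intro i
    induction i with
    | zero =>
      intro X hX hr
      have := ncard_le_fortythree_of_eRk_le_six_of_free M hfree hX (by simpa using hr)
      omega
    | succ i ih =>
      intro X hX hr
      have h := ncard_le_two_mul_add_one_of_free M hfree (k := 6 + i) (B := 44 * 2 ^ i - 1) ih X hX
        (by rw [show 6 + (i + 1) = 6 + i + 1 by ring] at hr; exact_mod_cast hr)
      have h2 : 1 ≤ 44 * 2 ^ i := Nat.one_le_iff_ne_zero.2 (by positivity)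
      calc X.ncard ≤ 2 * (44 * 2 ^ i - 1) + 1 := h
        _ = 44 * 2 ^ (i + 1) - 1 := by
          rw [pow_succ]
          omega
  intro u X hX hr
  have hXE : (X : Set α) ⊆ M.E := by rw [← coe_gr]; exact_mod_cast hX
  rcases Nat.lt_or_ge u 6 with h6 | h6
  · -- rank `≤ u < 6`: at most `43` points, and `44 · 2^0 − 1 = 43`
    have hr6 : M.eRk (X : Set α) ≤ ((6 + 0 : ℕ) : ℕ∞) := hr.trans (by exact_mod_cast (by omega : u ≤ 6 + 0))
    have := key 0 X hXE hr6
    rw [Set.ncard_coe_finset] at this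
    rw [show u - 6 = 0 by omega]
    simpa using this
  · obtain ⟨i, rfl⟩ : ∃ i, u = 6 + i := ⟨u - 6, by omega⟩
    have := key i X hXE hr
    rw [Set.ncard_coe_finset] at this
    rw [show 6 + i - 6 = i by omega]
    exact this

/-- **The large-corank cells of the `q = 6` window by the layers**: on the `e`-free core,
`Φ(p, 6) ≤ Σ_{1 ≤ k < p − 6} Π_{i<k} (n − (44·2^i − 1)) / (7 + i)` implies `RLS M p 6`. -/
theorem rls_six_of_layers_core [DecidableEq α] (M : Matroid α) [M.Finite] (p : ℕ)
    (hfree : ∀ e ∈ M.E, ∃ A ⊆ M.E \ {e}, e ∉ M.closure A ∧ e ∉ M.closure ((M.E \ {e}) \ A))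
    (hsum : phiK p 6 ≤ ∑ k ∈ Finset.Ico 1 (p - 6),
      layerProd M.E.ncard 6 (fun u => 44 * 2 ^ (u - 6) - 1) k) : RLS M p 6 := by
  have hn : (gr M).card = M.E.ncard := by
    rw [← coe_gr]; exact (Set.ncard_coe_finset _).symm
  rw [← hn] at hsum
  exact rls_of_layers M p 6 _ (card_le_coreBound_of_free M hfree) hsum

/-- **The first layer alone**: on the `e`-free core, `7·Φ(p, 6) ≤ n − 43` (and `8 ≤ p`) implies `RLS M p 6`. -/
theorem rls_six_of_first_layer_core [DecidableEq α] (M : Matroid α) [M.Finite] (p : ℕ) (hp : 8 ≤ p)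
    (hfree : ∀ e ∈ M.E, ∃ A ⊆ M.E \ {e}, e ∉ M.closure A ∧ e ∉ M.closure ((M.E \ {e}) \ A))
    (h : phiK p 6 * 7 ≤ ((M.E.ncard - 43 : ℕ) : ℚ)) : RLS M p 6 := by
  apply rls_six_of_layers_core M p hfree
  -- the term `k = 1` alone
  have h1 : layerProd M.E.ncard 6 (fun u => 44 * 2 ^ (u - 6) - 1) 1 = ((M.E.ncard - 43 : ℕ) : ℚ) / 7 := by
    simp only [layerProd]
    norm_num
  have hmem : (1 : ℕ) ∈ Finset.Ico 1 (p - 6) := by rw [Finset.mem_Ico]; omega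
  calc phiK p 6 ≤ ((M.E.ncard - 43 : ℕ) : ℚ) / 7 := by
        rw [le_div_iff₀ (by norm_num : (0 : ℚ) < 7)]; exact h
    _ = layerProd M.E.ncard 6 (fun u => 44 * 2 ^ (u - 6) - 1) 1 := h1.symm
    _ ≤ ∑ k ∈ Finset.Ico 1 (p - 6), layerProd M.E.ncard 6 (fun u => 44 * 2 ^ (u - 6) - 1) k :=
        Finset.single_le_sum (fun k _ => layerProd_nonneg _ _ _ k) hmem

/-- `Φ(9, 6) = 18/7`. -/
theorem phiK_nine_six : phiK 9 6 = 18 / 7 := by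
  unfold phiK
  rw [show Finset.Ioo 6 9 = {7, 8} from by decide]
  norm_num [Nat.choose]

/-- `Φ(10, 6) = 35750/8008`. -/
theorem phiK_ten_six : phiK 10 6 = 35750 / 8008 := by
  unfold phiK
  rw [show Finset.Ioo 6 10 = {7, 8, 9} from by decide]
  norm_num [Nat.choose]

/-- `Φ(11, 6) = 87516/12376`. -/
theorem phiK_eleven_six : phiK 11 6 = 87516 / 12376 := by
  unfold phiK
  rw [show Finset.Ioo 6 11 = {7, 8, 9, 10} from by decide]
  norm_num [Nat.choose]

/-- `Φ(12, 6) = 199784/18564`. -/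
theorem phiK_twelve_six : phiK 12 6 = 199784 / 18564 := by
  unfold phiK
  rw [show Finset.Ioo 6 12 = {7, 8, 9, 10, 11} from by decide]
  norm_num [Nat.choose]

/-- **The cell `(9, 6)` on the `e`-free core at every corank `≥ 52`** (`|E| ≥ 61`: `7·Φ(9,6) = 18 ≤ n − 43`). -/
theorem rls_nine_six_of_core [DecidableEq α] (M : Matroid α) [M.Finite]
    (hfree : ∀ e ∈ M.E, ∃ A ⊆ M.E \ {e}, e ∉ M.closure A ∧ e ∉ M.closure ((M.E \ {e}) \ A))
    (hn : 61 ≤ M.E.ncard) : RLS M 9 6 := by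
  refine rls_six_of_first_layer_core M 9 (by norm_num) hfree ?_
  rw [phiK_nine_six]
  have : (18 : ℚ) ≤ ((M.E.ncard - 43 : ℕ) : ℚ) := by exact_mod_cast (by omega : 18 ≤ M.E.ncard - 43)
  linarith

/-- **The cell `(10, 6)` on the `e`-free core at every corank `≥ 65`** (`|E| ≥ 75`). -/
theorem rls_ten_six_of_core [DecidableEq α] (M : Matroid α) [M.Finite]
    (hfree : ∀ e ∈ M.E, ∃ A ⊆ M.E \ {e}, e ∉ M.closure A ∧ e ∉ M.closure ((M.E \ {e}) \ A))
    (hn : 75 ≤ M.E.ncard) : RLS M 10 6 := by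
  refine rls_six_of_first_layer_core M 10 (by norm_num) hfree ?_
  rw [phiK_ten_six]
  have : (32 : ℚ) ≤ ((M.E.ncard - 43 : ℕ) : ℚ) := by exact_mod_cast (by omega : 32 ≤ M.E.ncard - 43)
  linarith

/-- **The cell `(11, 6)` on the `e`-free core at every corank `≥ 82`** (`|E| ≥ 93`). -/
theorem rls_eleven_six_of_core [DecidableEq α] (M : Matroid α) [M.Finite]
    (hfree : ∀ e ∈ M.E, ∃ A ⊆ M.E \ {e}, e ∉ M.closure A ∧ e ∉ M.closure ((M.E \ {e}) \ A))
    (hn : 93 ≤ M.E.ncard) : RLS M 11 6 := by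
  refine rls_six_of_first_layer_core M 11 (by norm_num) hfree ?_
  rw [phiK_eleven_six]
  have : (50 : ℚ) ≤ ((M.E.ncard - 43 : ℕ) : ℚ) := by exact_mod_cast (by omega : 50 ≤ M.E.ncard - 43)
  linarith

/-- **The cell `(12, 6)` on the `e`-free core at every corank `≥ 107`** (`|E| ≥ 119`). -/
theorem rls_twelve_six_of_core [DecidableEq α] (M : Matroid α) [M.Finite]
    (hfree : ∀ e ∈ M.E, ∃ A ⊆ M.E \ {e}, e ∉ M.closure A ∧ e ∉ M.closure ((M.E \ {e}) \ A))
    (hn : 119 ≤ M.E.ncard) : RLS M 12 6 := by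
  refine rls_six_of_first_layer_core M 12 (by norm_num) hfree ?_
  rw [phiK_twelve_six]
  have : (76 : ℚ) ≤ ((M.E.ncard - 43 : ℕ) : ℚ) := by exact_mod_cast (by omega : 76 ≤ M.E.ncard - 43)
  linarith

end PercRepro.ThmN
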